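import Mathlib

/-!
# `Summit.QuantumFields.Balaban3D.Proofs.GaussianNormalization` — the NORMALISATION step of [Balaban1985UV3] **(22)** p. 261 /
# **(55)** p. 269: an integral against `e^{−q(A)}dA` equals `Z·∫(·)dμ` with `μ` the normalised measure `Z⁻¹e^{−q}dA` and
# `Z = ∫e^{−q}dA` — whence the factor `exp[log Z^{(0)}(Ω₁, U₁)]` of (22) (resp. `log Z^{(k)}(B(Λ_{k+1}), U_{k+1})` of (55)) in front
# of the Gaussian integral `∫dμ_{C^{(0)}(Ω₁,U₁)}(A)⋯` — lane `pub-balaban3d`, seat p4 (ruling R-DISP: «(55) from (48)–(54) ← p4 =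
# finite-dimensional Gaussian normalisation … so (55) is a COMPUTATION, not an assumption»; D-p5-2: p1 DEFINES μ^{(k)} as the normalised
# Gaussian of the quadratic form of (53))

HONEST FRAMING (lane PLAN.md §0, binding): see `…Proofs.SectAFirstStep`.  Abstract measure theory (any measurable space `S` with a
reference measure `vol` and a measurable weight `q`); for the lane, `S` = the linear space of independent fluctuation variables
(p. 271 L24–26 «we write the integral in terms of the independent variables Ã … A = CÃ»), `vol` = its Lebesgue measure, `q = ½⟨A, ΔA⟩`
with `Δ = Δ(U₁)` of (19) / `Δ_k` of (53)–(54) (positivity = binder b9, [5] Sect. E).  Nothing of [Balaban1985UV3] is asserted; the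
Gaussian character of `μ` (mean zero, covariance `C = Δ⁻¹`) is not used here — only the normalisation algebra.

WHAT IS PRINTED.  (22) p. 261 L18–24 (render p007): «= Σ_{Ω₁} χ₁ ∫dV₀↾ ⋯ ζ_{Ω₁ᶜ} exp[−(1/g₀²)A(U₁) + log Z^{(0)}(Ω₁, U₁) − E + log σ₀|Ω₁*|
+ d(𝔤) log g₀|Ω₁*|] × ∫dμ_{C^{(0)}(Ω₁,U₁)}(A) χ exp[v(g₀A) − (1/g₀²)Ṽ(g₀A)]» obtained from the first member, an integral
«∫dA↾_{Ω₁} δ(QA)δ_{Ax}(A) χ exp[⋯ − ½⟨A, Δ(U₁)A⟩ ⋯]»; LQB records that `Z^{(0)}`, `C^{(0)}`, `Ṽ` are undefined in print at (22)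
(cell GAPS G-B10-03) — this file supplies the definition-and-identity that makes the step a computation.

WHAT THIS FILE PROVIDES (no `sorry`, axioms standard):
* `partZ vol q := ∫ e^{−q} d vol` (the normalising constant `Z`), `normalized vol q := Z⁻¹ • vol.withDensity e^{−q}` (the measure `μ`);
* `integral_normalized` — `∫ G dμ = Z⁻¹ · ∫ e^{−q}·G d vol`;
* `integral_exp_neg_mul_eq` — **the (22)/(55) step**: `∫ e^{−q(A)}·G(A) dA = Z · ∫ G dμ = exp(log Z) · ∫ G dμ` for `Z > 0`;
* `isProbabilityMeasure_normalized` — `μ` is a probability measure when `e^{−q}` is integrable with `Z > 0`.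
-/

namespace Summit.QuantumFields.Balaban3D.Proofs.GaussianNormalization

open MeasureTheory

variable {S : Type*} [MeasurableSpace S] (vol : Measure S) (q : S → ℝ)

/-- The normalising constant `Z = ∫ e^{−q(A)} dA` ((22): `Z^{(0)}(Ω₁, U₁)`; (55): `Z^{(k)}(B(Λ_{k+1}), U_{k+1})`). [cite: Balaban1985UV3, (22) p.261] -/
noncomputable def partZ : ℝ := ∫ A, Real.exp (-q A) ∂vol

/-- The NORMALISED measure `dμ = Z⁻¹ e^{−q(A)} dA` ((22): `dμ_{C^{(0)}(Ω₁,U₁)}`; for `q = ½⟨A, ΔA⟩` on a linear space with Lebesgue `dA`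
this is the mean-zero Gaussian of covariance `C = Δ⁻¹`). [cite: Balaban1985UV3, (22) p.261] -/
noncomputable def normalized : Measure S :=
  (ENNReal.ofReal (partZ vol q))⁻¹ • vol.withDensity (fun A => ENNReal.ofReal (Real.exp (-q A)))

variable {vol q}

/-- Integration against `μ`: `∫ G dμ = Z⁻¹·∫ e^{−q}·G d vol` (for measurable `q`). [folklore] -/
theorem integral_normalized (hq : Measurable q) (G : S → ℝ) :
    ∫ A, G A ∂(normalized vol q) = (partZ vol q)⁻¹ * ∫ A, Real.exp (-q A) * G A ∂vol := by
  unfold normalized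
  rw [integral_smul_measure]
  have hdens : ∫ A, G A ∂(vol.withDensity fun A => ENNReal.ofReal (Real.exp (-q A)))
      = ∫ A, Real.exp (-q A) * G A ∂vol := by
    have hmeas : Measurable fun A => Real.toNNReal (Real.exp (-q A)) :=
      (Real.measurable_exp.comp hq.neg).real_toNNReal
    have h := integral_withDensity_eq_integral_smul (μ := vol) hmeas G
    have hcoe : (fun A => ((Real.toNNReal (Real.exp (-q A)) : NNReal) : ENNReal)) = fun A => ENNReal.ofReal (Real.exp (-q A)) := by
      funext A; rfl
    rw [hcoe] at h
    rw [h]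
    refine integral_congr_ae (Filter.Eventually.of_forall fun A => ?_)
    show Real.toNNReal (Real.exp (-q A)) • G A = Real.exp (-q A) * G A
    rw [NNReal.smul_def, Real.coe_toNNReal _ (Real.exp_pos _).le, smul_eq_mul]
  rw [hdens, ENNReal.toReal_inv, ENNReal.toReal_ofReal_eq_iff.mpr ?_, smul_eq_mul]
  exact integral_nonneg fun A => (Real.exp_pos _).le

/-- **The normalisation step of (22) p. 261 / (55) p. 269 as a computation**: for `Z = ∫e^{−q} dA > 0`,
`∫ e^{−q(A)}·G(A) dA = Z·∫ G dμ` with `μ = Z⁻¹e^{−q}dA` — the factor `exp[log Z^{(0)}(Ω₁, U₁)]` that (22) moves into the exponent in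
front of `∫dμ_{C^{(0)}(Ω₁,U₁)}(A)⋯`. [cite: Balaban1985UV3, (22) p.261 + (55) p.269] -/
theorem integral_exp_neg_mul_eq (hq : Measurable q) (hZ : 0 < partZ vol q) (G : S → ℝ) :
    ∫ A, Real.exp (-q A) * G A ∂vol = partZ vol q * ∫ A, G A ∂(normalized vol q) := by
  rw [integral_normalized hq G, ← mul_assoc, mul_inv_cancel₀ hZ.ne', one_mul]

/-- The same with the constant in the exponent, as printed: `∫ e^{−q}·G dA = exp(log Z)·∫ G dμ`. [cite: Balaban1985UV3, (22) p.261] -/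
theorem integral_exp_neg_mul_eq_exp_log (hq : Measurable q) (hZ : 0 < partZ vol q) (G : S → ℝ) :
    ∫ A, Real.exp (-q A) * G A ∂vol = Real.exp (Real.log (partZ vol q)) * ∫ A, G A ∂(normalized vol q) := by
  rw [Real.exp_log hZ, integral_exp_neg_mul_eq hq hZ G]

/-- `μ` is a PROBABILITY measure when `e^{−q}` is integrable with `Z > 0` (for `q = ½⟨A, ΔA⟩`, Δ positive definite on a
finite-dimensional space: the Gaussian integral converges — binder b9 / (54)). [folklore] -/
theorem isProbabilityMeasure_normalized (hint : Integrable (fun A => Real.exp (-q A)) vol)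
    (hZ : 0 < partZ vol q) : IsProbabilityMeasure (normalized vol q) := by
  constructor
  unfold normalized
  rw [Measure.smul_apply, withDensity_apply _ MeasurableSet.univ, Measure.restrict_univ, smul_eq_mul]
  have hlin : ∫⁻ A, ENNReal.ofReal (Real.exp (-q A)) ∂vol = ENNReal.ofReal (partZ vol q) := by
    unfold partZ
    rw [ofReal_integral_eq_lintegral_ofReal hint (Filter.Eventually.of_forall fun A => (Real.exp_pos _).le)]
  rw [hlin, ENNReal.inv_mul_cancel (by simpa using hZ) ENNReal.ofReal_ne_top]

end Summit.QuantumFields.Balaban3D.Proofs.GaussianNormalization
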